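import Summits.ResolutionOfSingularities.ResolutionOfSingularities.Theorems.FrobeniusLadderFInjectiveMacaulayficationFCentreE1ChartWitness
import Summits.ResolutionOfSingularities.ResolutionOfSingularities.Theorems.FrobeniusLadderFInjectiveMacaulayficationFCentreCandidate
import HarnessLib

/-!
# R17.11 TIER-1, PLUMBING PART 1: the rung-0 input `(Spec 𝒪_{X,v}, 𝟙, ⊤)` of the P2d4C specimen is a LEGAL input of `LFBAdm 2 1 4` — the instantiation
# (crux `FInjectiveMacaulayfication` stmt-ResolutionOfSingularities-15315, chain w45a; res-L1-w45a-plan-1 RULING R17.11 (2), SEAT TABLE v31.2 row stub-1;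
# res-L1-w45a-tri-2 03:18:48Z «binders hold: closed ✓ isolated (∂_z = x⁴, ∂_x = 0, ∂_y = y², ∂_u = u², ∂_t = t²) ✓ dim 4 ✓ regular off the closed point ✓ CMCl ✓»;
# seat res-L1-w45a-stub-1 g9)

[OURS · L1 W4.5a] Support file (`--supports stmt-ResolutionOfSingularities-15315 --as helper`); replaces the role of NO printed item; NOT a
statement of the manuscript; def-free, unconditional. AI-written (AI review is weaker than expert review).

## What is here (`X 0 = x`, `X 1 = y`, `X 2 = u`, `X 3 = t`, `X 4 = z`; `f = z² + x⁴z + y³ + u³ + t³`, `char k = 2`, `X = Spec k[X]/(f)`, `v` = the origin)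
* §1 `regular_off_vertex` — `(k[X]/(f))_P` is regular at every prime `P ⊉ (x̄, ȳ, ū, t̄, z̄)` (Jacobian: `∂_y f = y²`, `∂_u f = u²`, `∂_t f = t²`, `∂_z f = x⁴`;
  if `x, y, u, t ∈ P` then `z² = f − x⁴z − Σ ∈ P`).
* §2 the binders of `FCentreCandidate.LFBAdm 2 1 4` / `GermForm.LocalFInjectivizationGerm 2 4` at `(X, v)`: `isClosed_vertex`, `vertex_not_mem_regularLocus` (`∇f(0) = 0`),
  `ringKrullDim_stalk_vertex = 4`, `regular_off_closedPoint_vertex` (isolated), `cmCl_Spec_stalk_vertex`, `isIntegral_p2d4c`; the structure-morphism binders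
  are `FermatCubicConeGerm.structureMorphism_*` (generic).
* §3 ★ `lFBAdm_at_p2d4c` — **the instantiation**: `LFBAdm 2 1 4` ⇒ at the input `(S′, g, I) := (Spec 𝒪_{X,v}, 𝟙, ⊤)` there is `𝓚 ≠ ⊥` on `Spec 𝒪_{X,v}`, cosupported at
  the closed point, admissible, with (c4) every blowing up along `𝓚` an `F`-blowup `IsFBlowup 2 1` and (c5) every blowing up along `𝓚` FULL everywhere. What then
  remains for the Tier-1 ✗ `FrobeniusNormP2d4C → ¬ LFBAdm 2 1 4` is «(c4) ∧ (c5) ∧ LEMMA N ⇒ False»: F-blowup uniqueness (`IsFBlowup.isBlowup_of_isFrobeniusNormIdeal`)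
  + the monomial chart presentation of `Bl_{𝔮⁴}` + `FCentreE1ChartWitness.not_fullCl_chartOrigin` (p604021).

[folklore mathematics, OURS as a certificate; cite: Hartshorne1977, I Thm. 5.1; Matsumura1987, Thm. 17.4; Yasuda2012, Def. 2.2 (context)]
-/

-- single-problem summit: the doubled namespace component is forced
set_option linter.dupNamespace false

noncomputable section

open AlgebraicGeometry CategoryTheory Literature.AlgebraicGeometry.Resolution TopologicalSpace IsLocalRing MvPolynomial

namespace Summit.ResolutionOfSingularities.ResolutionOfSingularities.Theorems.FInjectiveMacaulayfication.FCentreE1RungZero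

open Summit.ResolutionOfSingularities.ResolutionOfSingularities.Theorems.FInjectiveMacaulayfication
open SliceableCentre GermForm GermOfGlobalBlowup FCentreE1ChartWitness

/-! ## §1 Partial derivatives; regularity off the vertex -/

/-- `∂f/∂z = 2z + x⁴` (`= x⁴` in characteristic 2). [folklore] -/
theorem pderiv_four_f (k : Type) [Field k] [CharP k 2] (f : MvPolynomial (Fin 5) k)
    (hf : f = X 4 ^ 2 + X 0 ^ 4 * X 4 + X 1 ^ 3 + X 2 ^ 3 + X 3 ^ 3) : pderiv 4 f = X 0 ^ 4 := by
  have h2 : (2 : MvPolynomial (Fin 5) k) = 0 := (FermatCubicConeChar2.two_three k (n := 5)).1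
  rw [hf]
  simp only [map_add, Derivation.leibniz, pderiv_pow, pderiv_X_self, pderiv_X_of_ne (show (0 : Fin 5) ≠ 4 by decide),
    pderiv_X_of_ne (show (1 : Fin 5) ≠ 4 by decide), pderiv_X_of_ne (show (2 : Fin 5) ≠ 4 by decide),
    pderiv_X_of_ne (show (3 : Fin 5) ≠ 4 by decide), smul_eq_mul, mul_zero, mul_one, add_zero]
  push_cast
  rw [h2]
  ring

/-- `∂f/∂y = 3y²`, `∂f/∂u = 3u²`, `∂f/∂t = 3t²` (`= y², u², t²` in characteristic 2). [folklore] -/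
theorem pderiv_cube_f (k : Type) [Field k] [CharP k 2] (f : MvPolynomial (Fin 5) k)
    (hf : f = X 4 ^ 2 + X 0 ^ 4 * X 4 + X 1 ^ 3 + X 2 ^ 3 + X 3 ^ 3) (j : Fin 5) (hj1 : j = 1 ∨ j = 2 ∨ j = 3) :
    pderiv j f = X j ^ 2 := by
  have h3 : (3 : MvPolynomial (Fin 5) k) = 1 := (FermatCubicConeChar2.two_three k (n := 5)).2
  rw [hf]
  rcases hj1 with rfl | rfl | rfl
  all_goals
    simp only [map_add, Derivation.leibniz, pderiv_pow, pderiv_X_self, smul_eq_mul, pderiv_X_of_ne (show (4 : Fin 5) ≠ 1 by decide),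
      pderiv_X_of_ne (show (0 : Fin 5) ≠ 1 by decide), pderiv_X_of_ne (show (2 : Fin 5) ≠ 1 by decide),
      pderiv_X_of_ne (show (3 : Fin 5) ≠ 1 by decide), pderiv_X_of_ne (show (4 : Fin 5) ≠ 2 by decide),
      pderiv_X_of_ne (show (0 : Fin 5) ≠ 2 by decide), pderiv_X_of_ne (show (1 : Fin 5) ≠ 2 by decide),
      pderiv_X_of_ne (show (3 : Fin 5) ≠ 2 by decide), pderiv_X_of_ne (show (4 : Fin 5) ≠ 3 by decide),
      pderiv_X_of_ne (show (0 : Fin 5) ≠ 3 by decide), pderiv_X_of_ne (show (1 : Fin 5) ≠ 3 by decide),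
      pderiv_X_of_ne (show (2 : Fin 5) ≠ 3 by decide), mul_zero, mul_one, zero_add, add_zero]
    push_cast
    rw [h3]
    ring

/-- **`(k[X]/(f))_P` is regular at every prime `P ⊉ (x̄, ȳ, ū, t̄, z̄)`** (`f = z² + x⁴z + y³ + u³ + t³`, char 2): some variable misses `P`; `y, u, t ∉ P` ⇒ Jacobian
with `∂ = (variable)²`; `x ∉ P` ⇒ Jacobian with `∂_z f = x⁴`; and `z` cannot be the only one outside `P` (`z² = f − x⁴z − Σ ∈ P`). [cite: Hartshorne1977, I Thm. 5.1] -/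
theorem regular_off_vertex (k : Type) [Field k] [CharP k 2] (f : MvPolynomial (Fin 5) k)
    (hf : f = X 4 ^ 2 + X 0 ^ 4 * X 4 + X 1 ^ 3 + X 2 ^ 3 + X 3 ^ 3)
    (P : Ideal (MvPolynomial (Fin 5) k ⧸ Ideal.span {f})) [P.IsPrime]
    (hP : ¬ Ideal.span (Set.range fun j : Fin 5 => Ideal.Quotient.mk (Ideal.span {f}) (X j)) ≤ P) :
    IsRegularLocalRing (Localization.AtPrime P) := by
  have hP' : (P.comap (Ideal.Quotient.mk (Ideal.span {f}))).IsPrime := Ideal.comap_isPrime _ _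
  set P' := P.comap (Ideal.Quotient.mk (Ideal.span {f})) with hP'def
  -- one of `x, y, u, t` misses `P`
  have hex : ∃ j : Fin 5, j ≠ 4 ∧ (X j : MvPolynomial (Fin 5) k) ∉ P' := by
    by_contra hall
    push Not at hall
    apply hP
    rw [Ideal.span_le]
    rintro _ ⟨j, rfl⟩
    change X j ∈ P'
    by_cases hj : j = 4
    · subst hj
      have hfP : f ∈ P' := FermatCubicConeChar2.self_mem_comap f P
      have hx : (X 0 : MvPolynomial (Fin 5) k) ∈ P' := hall 0 (by decide)
      have hy : (X 1 : MvPolynomial (Fin 5) k) ∈ P' := hall 1 (by decide)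
      have hu : (X 2 : MvPolynomial (Fin 5) k) ∈ P' := hall 2 (by decide)
      have ht : (X 3 : MvPolynomial (Fin 5) k) ∈ P' := hall 3 (by decide)
      have hz2 : (X 4 : MvPolynomial (Fin 5) k) ^ 2 ∈ P' := by
        have e : (X 4 : MvPolynomial (Fin 5) k) ^ 2 = f - (X 0 ^ 4 * X 4 + X 1 ^ 3 + X 2 ^ 3 + X 3 ^ 3) := by rw [hf]; ring
        rw [e]
        refine Ideal.sub_mem _ hfP (Ideal.add_mem _ (Ideal.add_mem _ (Ideal.add_mem _ ?_ ?_) ?_) ?_)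
        · exact Ideal.mul_mem_right _ _ (Ideal.pow_mem_of_mem _ hx 4 (by norm_num))
        · exact Ideal.pow_mem_of_mem _ hy 3 (by norm_num)
        · exact Ideal.pow_mem_of_mem _ hu 3 (by norm_num)
        · exact Ideal.pow_mem_of_mem _ ht 3 (by norm_num)
      exact hP'.mem_of_pow_mem 2 hz2
    · exact hall j hj
  obtain ⟨j, hj4, hj⟩ := hex
  by_cases hj0 : j = 0
  · subst hj0
    exact HypersurfaceRegular.stub_hypersurfaceRegularOfPderiv k 5 f 4 P
      (by rw [pderiv_four_f k f hf]; exact fun h => hj (hP'.mem_of_pow_mem 4 h))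
  · have hj123 : j = 1 ∨ j = 2 ∨ j = 3 := by
      fin_cases j <;> simp_all
    exact HypersurfaceRegular.stub_hypersurfaceRegularOfPderiv k 5 f j P
      (by rw [pderiv_cube_f k f hf j hj123]; exact fun h => hj (hP'.mem_of_pow_mem 2 h))

/-! ## §2 The binders at the vertex -/

/-- (H1) the vertex is closed. [folklore] -/
theorem isClosed_vertex (k : Type) [Field k] (f : MvPolynomial (Fin 5) k)
    (hf : f = X 4 ^ 2 + X 0 ^ 4 * X 4 + X 1 ^ 3 + X 2 ^ 3 + X 3 ^ 3)
    (v : Spec (.of (MvPolynomial (Fin 5) k ⧸ Ideal.span {f})))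
    (hv : v.asIdeal = Ideal.span (Set.range fun j : Fin 5 => Ideal.Quotient.mk (Ideal.span {f}) (X j))) :
    IsClosed ({v} : Set (Spec (.of (MvPolynomial (Fin 5) k ⧸ Ideal.span {f})))) :=
  DoublePointFermatCubicGerm.isClosed_origin k f (constantCoeff_f k f hf) v hv

/-- (H2) the vertex is NOT regular: `f(0) = 0`, `∇f(0) = 0`. [cite: Hartshorne1977, I Thm. 5.1] -/
theorem vertex_not_mem_regularLocus (k : Type) [Field k] [CharP k 2] (f : MvPolynomial (Fin 5) k)
    (hf : f = X 4 ^ 2 + X 0 ^ 4 * X 4 + X 1 ^ 3 + X 2 ^ 3 + X 3 ^ 3)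
    (v : Spec (.of (MvPolynomial (Fin 5) k ⧸ Ideal.span {f})))
    (hv : v.asIdeal = Ideal.span (Set.range fun j : Fin 5 => Ideal.Quotient.mk (Ideal.span {f}) (X j))) :
    v ∉ Scheme.regularLocus (Spec (.of (MvPolynomial (Fin 5) k ⧸ Ideal.span {f}))) := by
  classical
  refine not_mem_regularLocus_Spec_of_not_isRegularLocalRing v ?_
  refine not_isRegularLocalRing_localization_of_pderiv_eval_eq_zero (0 : Fin 5 → k) (prime_f k f hf).ne_zero ?_ ?_ v.asIdeal ?_
  · rw [MvPolynomial.eval_zero]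
    exact constantCoeff_f k f hf
  · intro i
    by_cases hi4 : i = 4
    · subst hi4
      rw [pderiv_four_f k f hf, map_pow, MvPolynomial.eval_X, Pi.zero_apply, zero_pow four_ne_zero]
    by_cases hi0 : i = 0
    · subst hi0
      rw [hf]
      simp only [map_add, Derivation.leibniz, pderiv_pow, pderiv_X_self, smul_eq_mul, map_mul, map_pow, map_natCast,
        MvPolynomial.eval_X, Pi.zero_apply, pderiv_X_of_ne (show (4 : Fin 5) ≠ 0 by decide),
        pderiv_X_of_ne (show (1 : Fin 5) ≠ 0 by decide), pderiv_X_of_ne (show (2 : Fin 5) ≠ 0 by decide),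
        pderiv_X_of_ne (show (3 : Fin 5) ≠ 0 by decide)]
      simp
    · have hi : i = 1 ∨ i = 2 ∨ i = 3 := by fin_cases i <;> simp_all
      rw [pderiv_cube_f k f hf i hi, map_pow, MvPolynomial.eval_X, Pi.zero_apply, zero_pow two_ne_zero]
  · rw [hv, DoublePointFermatCubicGerm.comap_origin k f (constantCoeff_f k f hf), MvPolynomial.eval_zero, Fedder.span_range_X_eq_ker]

/-- (H3) `dim 𝒪_{X,v} = 4`. [cite: Matsumura1987, Thm. 13.5] -/
theorem ringKrullDim_stalk_vertex (k : Type) [Field k] [CharP k 2] (f : MvPolynomial (Fin 5) k)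
    (hf : f = X 4 ^ 2 + X 0 ^ 4 * X 4 + X 1 ^ 3 + X 2 ^ 3 + X 3 ^ 3)
    (v : Spec (.of (MvPolynomial (Fin 5) k ⧸ Ideal.span {f})))
    (hv : v.asIdeal = Ideal.span (Set.range fun j : Fin 5 => Ideal.Quotient.mk (Ideal.span {f}) (X j))) :
    ringKrullDim ((Spec (.of (MvPolynomial (Fin 5) k ⧸ Ideal.span {f}))).presheaf.stalk v) = (4 : ℕ) := by
  haveI : v.asIdeal.IsMaximal := by
    rw [hv]
    exact DoublePointFermatCubicGerm.isMaximal_origin k f (constantCoeff_f k f hf)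
  rw [ringKrullDim_stalk_Spec_eq]
  exact HypersurfaceLocalDim.stub_hypersurfaceLocalDim k 4 f (prime_f k f hf).ne_zero v.asIdeal

/-- `X` is regular at every point other than the vertex. [cite: Hartshorne1977, I Thm. 5.1] -/
theorem regular_of_ne_vertex (k : Type) [Field k] [CharP k 2] (f : MvPolynomial (Fin 5) k)
    (hf : f = X 4 ^ 2 + X 0 ^ 4 * X 4 + X 1 ^ 3 + X 2 ^ 3 + X 3 ^ 3)
    (v : Spec (.of (MvPolynomial (Fin 5) k ⧸ Ideal.span {f})))
    (hv : v.asIdeal = Ideal.span (Set.range fun j : Fin 5 => Ideal.Quotient.mk (Ideal.span {f}) (X j))) :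
    ∀ y : Spec (.of (MvPolynomial (Fin 5) k ⧸ Ideal.span {f})), y ⤳ v → y ≠ v →
      y ∈ Scheme.regularLocus (Spec (.of (MvPolynomial (Fin 5) k ⧸ Ideal.span {f}))) := by
  intro y hy hne
  refine FermatCubicConeGerm.mem_regularLocus_Spec_of_isRegularLocalRing y (regular_off_vertex k f hf y.asIdeal fun hle => hne ?_)
  have h2 : y.asIdeal ≤ v.asIdeal := (PrimeSpectrum.le_iff_specializes y v).mpr hy
  exact PrimeSpectrum.ext (le_antisymm h2 (hv ▸ hle))

/-- (H4) ISOLATED: `Spec 𝒪_{X,v}` is regular off its closed point. [cite: Temkin2008, §2.1] -/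
theorem regular_off_closedPoint_vertex (k : Type) [Field k] [CharP k 2] (f : MvPolynomial (Fin 5) k)
    (hf : f = X 4 ^ 2 + X 0 ^ 4 * X 4 + X 1 ^ 3 + X 2 ^ 3 + X 3 ^ 3)
    (v : Spec (.of (MvPolynomial (Fin 5) k ⧸ Ideal.span {f})))
    (hv : v.asIdeal = Ideal.span (Set.range fun j : Fin 5 => Ideal.Quotient.mk (Ideal.span {f}) (X j))) :
    ∀ s : Spec ((Spec (.of (MvPolynomial (Fin 5) k ⧸ Ideal.span {f}))).presheaf.stalk v),
      s ≠ closedPoint _ → s ∈ Scheme.regularLocus (Spec ((Spec (.of (MvPolynomial (Fin 5) k ⧸ Ideal.span {f}))).presheaf.stalk v)) :=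
  regularLocus_Spec_stalk_of_isolated v (regular_of_ne_vertex k f hf v hv)

/-- (H5) the CM-clause at every point of `Spec 𝒪_{X,v}`. [cite: Matsumura1987, Thm. 17.4 and Thm. 17.8] -/
theorem cmCl_Spec_stalk_vertex (k : Type) [Field k] [CharP k 2] (f : MvPolynomial (Fin 5) k)
    (hf : f = X 4 ^ 2 + X 0 ^ 4 * X 4 + X 1 ^ 3 + X 2 ^ 3 + X 3 ^ 3)
    (v : Spec (.of (MvPolynomial (Fin 5) k ⧸ Ideal.span {f})))
    (hv : v.asIdeal = Ideal.span (Set.range fun j : Fin 5 => Ideal.Quotient.mk (Ideal.span {f}) (X j))) :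
    ∀ s : Spec ((Spec (.of (MvPolynomial (Fin 5) k ⧸ Ideal.span {f}))).presheaf.stalk v),
      CMCl ((Spec ((Spec (.of (MvPolynomial (Fin 5) k ⧸ Ideal.span {f}))).presheaf.stalk v)).presheaf.stalk s) :=
  cmCl_Spec_stalk_of_isolated v (cmCl_stalk_Spec_of_cmCl_localization v
    (DoublePointFermatCubicGerm.cmCl_localization_hypersurface k f (prime_f k f hf).ne_zero v)) (regular_of_ne_vertex k f hf v hv)

/-- `X` is integral. [folklore] -/
theorem isIntegral_p2d4c (k : Type) [Field k] [CharP k 2] (f : MvPolynomial (Fin 5) k)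
    (hf : f = X 4 ^ 2 + X 0 ^ 4 * X 4 + X 1 ^ 3 + X 2 ^ 3 + X 3 ^ 3) :
    IsIntegral (Spec (.of (MvPolynomial (Fin 5) k ⧸ Ideal.span {f}))) := by
  haveI := (Ideal.span_singleton_prime (prime_f k f hf).ne_zero).mpr (prime_f k f hf)
  haveI : IsDomain (MvPolynomial (Fin 5) k ⧸ Ideal.span {f}) := Ideal.Quotient.isDomain _
  infer_instance

/-! ## §3 The instantiation of `LFBAdm 2 1 4` at the rung-0 input -/

/-- ★ **`LFBAdm 2 1 4` AT THE RUNG-0 INPUT OF R17.11.** If `FCentreCandidate.LFBAdm 2 1 4` holds then, for `X = V(z² + x⁴z + y³ + u³ + t³)` over any field of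
characteristic 2 and its vertex `v`, at the input `(S′, g, I) = (Spec 𝒪_{X,v}, 𝟙, ⊤)` (legal: `⊤ ≠ ⊥`, `supp ⊤ = ∅`, `𝟙` a blowing up along `⊤`, and §2) there is
`𝓚 ≠ ⊥` on `Spec 𝒪_{X,v}`, cosupported at the closed point and admissible, such that (c4) EVERY blowing up along `𝓚` is a first Frobenius blow-up
`IsFBlowup 2 1` and (c5) EVERY blowing up along `𝓚` is FULL at every point. (The Tier-1 ✗ then reads: (c4) + LEMMA N force that blow-up to be `Bl_{𝔮⁴}`, whose
`x`-chart is NOT FULL at its origin — `FCentreE1ChartWitness.not_fullCl_chartOrigin`.) [OURS · instantiation of a candidate statement; cite: Yasuda2012, Def. 2.2] -/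
theorem lFBAdm_at_p2d4c (h : FCentreCandidate.LFBAdm 2 1 4) (k : Type) [Field k] [CharP k 2] (f : MvPolynomial (Fin 5) k)
    (hf : f = X 4 ^ 2 + X 0 ^ 4 * X 4 + X 1 ^ 3 + X 2 ^ 3 + X 3 ^ 3)
    (v : Spec (.of (MvPolynomial (Fin 5) k ⧸ Ideal.span {f})))
    (hv : v.asIdeal = Ideal.span (Set.range fun j : Fin 5 => Ideal.Quotient.mk (Ideal.span {f}) (X j))) :
    ∃ 𝓚 : (Spec ((Spec (.of (MvPolynomial (Fin 5) k ⧸ Ideal.span {f}))).presheaf.stalk v)).IdealSheafData, 𝓚 ≠ ⊥ ∧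
      (∀ s ∈ (𝓚.support : Set (Spec ((Spec (.of (MvPolynomial (Fin 5) k ⧸ Ideal.span {f}))).presheaf.stalk v))),
        (𝟙 (Spec ((Spec (.of (MvPolynomial (Fin 5) k ⧸ Ideal.span {f}))).presheaf.stalk v)) : _ ⟶ _).base s =
          closedPoint ((Spec (.of (MvPolynomial (Fin 5) k ⧸ Ideal.span {f}))).presheaf.stalk v)) ∧
      (𝓚.support : Set _) ⊆ (Scheme.regularLocus (Spec ((Spec (.of (MvPolynomial (Fin 5) k ⧸ Ideal.span {f}))).presheaf.stalk v)))ᶜ ∧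
      (∀ [IsIntegral (Spec ((Spec (.of (MvPolynomial (Fin 5) k ⧸ Ideal.span {f}))).presheaf.stalk v))]
          [ExpChar (Spec ((Spec (.of (MvPolynomial (Fin 5) k ⧸ Ideal.span {f}))).presheaf.stalk v)).functionField 2]
          (S'' : Scheme.{0}) (π : S'' ⟶ Spec ((Spec (.of (MvPolynomial (Fin 5) k ⧸ Ideal.span {f}))).presheaf.stalk v)),
          IsBlowup π 𝓚 → IsFBlowup 2 1 π) ∧
      ∀ (S'' : Scheme.{0}) (π : S'' ⟶ Spec ((Spec (.of (MvPolynomial (Fin 5) k ⧸ Ideal.span {f}))).presheaf.stalk v)), IsBlowup π 𝓚 →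
        ∀ s : S'', FullCl 2 (S''.presheaf.stalk s) := by
  haveI := isIntegral_p2d4c k f hf
  exact h Nat.prime_two k (Spec (.of (MvPolynomial (Fin 5) k ⧸ Ideal.span {f})))
    (Spec.map (CommRingCat.ofHom (algebraMap k (MvPolynomial (Fin 5) k ⧸ Ideal.span {f}))))
    (FermatCubicConeGerm.structureMorphism_isSeparated k f) (FermatCubicConeGerm.structureMorphism_locallyOfFiniteType k f)
    (FermatCubicConeGerm.structureMorphism_quasiCompact k f) inferInstance v (isClosed_vertex k f hf v hv)
    (vertex_not_mem_regularLocus k f hf v hv) (ringKrullDim_stalk_vertex k f hf v hv) (Spec _) (𝟙 _) ⊤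
    (top_ne_bot_idealSheafData_Spec_stalk v) (support_top_subset _) (isBlowup_id_top _)
    (fun s hs => regular_off_closedPoint_vertex k f hf v hv s (by simpa using hs)) (cmCl_Spec_stalk_vertex k f hf v hv)

end Summit.ResolutionOfSingularities.ResolutionOfSingularities.Theorems.FInjectiveMacaulayfication.FCentreE1RungZero

end
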